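import Literature.MathematicalPhysics.KineticTheory.SiteChainLangevinKernel
import Literature.Analysis.Distribution.Hypoelliptic
import Mathlib.LinearAlgebra.Matrix.Trace
import HarnessLib

/-!
# Site-inhomogeneous Langevin chains: the Fokker–Planck operator in Hörmander's form

Topic `Literature/MathematicalPhysics/KineticTheory`, grouping namespace `…KineticTheory.HeatConduction`.
Twin, for the SITE-DEPENDENT chains `SiteChain` of `CellChain.lean` (pinning `U i` at site `i`, bond
potential `V i` on the bond `(i, i+1)`, one bath coupling `γ` at the sites `0` and `N - 1`: the
oscillator NETWORK of Cuneo–Eckmann–Hairer–Rey-Bellet 2018 on the path graph), of the Hörmander half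
of `LangevinChainHormander.lean` (which does the same for the homogeneous `OscillatorChain`): the
calculus of the Fokker–Planck drift `X₀ = -Y` (`Y = P.langevinDrift N` the Langevin drift of
`SiteChainConfined.lean`) and the identification of the generator `L = P.generator N T_L T_R` with
the formal transpose of the Fokker–Planck operator `L* = X_L² + X_R² + X₀ + 2γ` written in
Hörmander's form (1.6).

* `SiteChain.d2Potential` — closed form of the Hessian `∂²Φ/∂q_j∂q_i` of the potential energy
  `Φ(q) = ∑_i U_i(q_i) + ∑_i V_i(q_{i+1} - q_i)` (tridiagonal: `d2Potential_eq_zero_of_le`;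
  sub-diagonal entry `-V_j''(q_{j+1} - q_j)`: `d2Potential_succ`), with `hasDerivAt_d2Potential`;
* `SiteChain.adjointLangevinDrift` — the field `X₀ = -Y`, its closed form, smoothness, derivative
  (`fderiv_adjointLangevinDrift_apply`: `DX₀(x) v = (-v.2, Hess Φ(q) v.1 + γ 1_B v.2)`) and
  divergence `div X₀ = 2γ` (`fieldDiv_adjointLangevinDrift`);
* `SiteChain.langevinBathField` — the constant bath fields `X_b = √(γT_b) ∂_{p_b}`, `b ∈ {L, R}`;
  `SiteChain.hormanderTranspose_eq_generator`: `ᵗ(X_L² + X_R² + X₀ + 2γ) f = L f` for smooth `f`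
  (so a weakly stationary measure, `∫ L f dμ = 0`, is a distribution solution of `L* μ = 0`);
* `SiteChain.langevinHormanderFamily` (`(X₀, X_L, X_R)` indexed by `Option (Fin 2)` as in
  `Literature.Analysis.Distribution.Hormander1967_thm11`) and the iterated brackets
  `SiteChain.langevinBracketSeq` (`Z_0 = X_L`, `Z_{k+1} = [X₀, Z_k]`) with the recursion
  `langevinBracketSeq_succ_apply`.

The bracket condition (CEHRB Prop. 4.1 for site chains with `V_i'' ≠ 0`) and the smooth-density
consequence of Hörmander's Theorem 1.1 are in `SiteChainHormanderBrackets.lean`.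

## References

* N. Cuneo, J.-P. Eckmann, M. Hairer, L. Rey-Bellet, *Non-equilibrium steady states for networks of
  oscillators*, Electron. J. Probab. **23** (2018) no. 55: §2 eq. (2.2), §3 eq. (3.2) and §3.1
  (`L = X_0 + ∑ X_{b,i}²`, `L*` its formal adjoint), Prop. 4.1.
* L. Hörmander, *Hypoelliptic second order differential equations*, Acta Math. **119** (1967)
  147–171, eq. (1.6), Thm 1.1.

## Design choices

* Everything is stated for a general `P : SiteChain` under SITEWISE smoothness hypotheses
  `∀ i, ContDiff ℝ ∞ (P.U i)`, `∀ i, ContDiff ℝ ∞ (P.V i)`; the generic phase-space calculus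
  (`unitQ/unitP`, `clm_apply_eq_sum`, `OscillatorChain.bathWeight/bathSite/bathTemp`,
  `fieldTranspose_const`, `fieldTranspose_fieldTranspose_const_smul`) is imported, not copied.
* The calculus is phrased for `X₀ = -Y` directly (the field entering Hörmander's family), not for `Y`.
* NOT here: the triangular structure of the brackets, the bracket condition, smooth densities
  (next file); nothing specific to cell chains.
-/

noncomputable section

open MeasureTheory Filter Topology Set Function Finset
open scoped ContDiff NNReal ENNReal

namespace Literature.MathematicalPhysics.KineticTheory.HeatConduction

open Literature.MathematicalPhysics.KineticTheory Literature.Analysis.Distribution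

variable {N : ℕ}

namespace SiteChain

variable (P : SiteChain)

/-! ### The Hessian of the potential energy -/

/-- Closed form of the Hessian entry `∂²Φ/∂q_j ∂q_i` of the potential energy of a site chain:
`U_i''(q_i) [i = j] + ∑_{l = k+1} V_k''(q_l - q_k) ([l = j] - [k = j]) ([l = i] - [k = i])`.
[folklore] -/
def d2Potential (N : ℕ) (i j : Fin N) (q : Fin N → ℝ) : ℝ :=
  deriv (deriv (P.U i.val)) (q i) * (if i = j then 1 else 0) + ∑ k : Fin N, ∑ l : Fin N,
    if l.val = k.val + 1 then
      deriv (deriv (P.V k.val)) (q l - q k) * ((if l = j then 1 else 0) - (if k = j then 1 else 0)) *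
        ((if l = i then 1 else 0) - (if k = i then 1 else 0)) else 0

/-- `s ↦ ∂Φ/∂q_i (q + s e_j)` has derivative `∂²Φ/∂q_j∂q_i (q)` (closed form `d2Potential`) at
`s = 0`, for potentials with differentiable derivatives. [folklore] -/
theorem hasDerivAt_d2Potential (hU : ∀ i, Differentiable ℝ (deriv (P.U i)))
    (hV : ∀ i, Differentiable ℝ (deriv (P.V i))) (N : ℕ) (q : Fin N → ℝ) (i j : Fin N) :
    HasDerivAt (fun s : ℝ => P.dPotential N i (q + s • Pi.single j 1))
      (P.d2Potential N i j q) 0 := by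
  have hlin : HasDerivAt (fun s : ℝ => q + s • (Pi.single j (1 : ℝ) : Fin N → ℝ))
      (Pi.single j 1) 0 := by
    simpa using ((hasDerivAt_id (0 : ℝ)).smul_const (Pi.single j (1 : ℝ) : Fin N → ℝ)).const_add q
  have hco : ∀ m : Fin N, HasDerivAt (fun s : ℝ => (q + s • (Pi.single j (1 : ℝ) : Fin N → ℝ)) m)
      (if m = j then 1 else 0) 0 := fun m => by
    have := (hasDerivAt_pi.1 hlin) m
    simpa [Pi.single_apply] using this
  have h0 : ∀ m : Fin N, (q + (0 : ℝ) • (Pi.single j (1 : ℝ) : Fin N → ℝ)) m = q m := fun m => by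
    simp
  unfold dPotential d2Potential
  refine HasDerivAt.add ?_ ?_
  · have := ((hU i.val _).hasDerivAt).comp (0 : ℝ) (hco i)
    simpa [Function.comp_def, h0] using this
  · refine HasDerivAt.fun_sum fun k _ => HasDerivAt.fun_sum fun l _ => ?_
    by_cases hlk : l.val = k.val + 1
    · simp only [hlk, if_true]
      have hcomp := ((((hV k.val _).hasDerivAt).comp (0 : ℝ) ((hco l).sub (hco k))).mul_const
        ((if l = i then (1 : ℝ) else 0) - (if k = i then 1 else 0)))
      simpa [Function.comp_def, h0] using hcomp
    · simp only [hlk, if_false]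
      exact hasDerivAt_const _ _

/-- Far off the tridiagonal the Hessian of `Φ` vanishes: `∂²Φ/∂q_j∂q_i = 0` for `i ≥ j + 2`
(each bond couples nearest neighbours only). [folklore] -/
theorem d2Potential_eq_zero_of_le (N : ℕ) {i j : Fin N} (h : j.val + 2 ≤ i.val)
    (q : Fin N → ℝ) : P.d2Potential N i j q = 0 := by
  unfold d2Potential
  have hij : i ≠ j := by intro e; subst e; omega
  simp only [hij, if_false, mul_zero, zero_add]
  refine Finset.sum_eq_zero fun k _ => Finset.sum_eq_zero fun l _ => ?_
  simp only [Fin.ext_iff]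
  split_ifs <;> first | (exfalso; omega) | simp

/-- The sub-diagonal Hessian entry: `∂²Φ/∂q_j∂q_{j+1} = -V_j''(q_{j+1} - q_j)` (the bond `(j, j+1)`
carries the potential `V j`). [folklore] -/
theorem d2Potential_succ (N : ℕ) {i j : Fin N} (h : i.val = j.val + 1) (q : Fin N → ℝ) :
    P.d2Potential N i j q = -deriv (deriv (P.V j.val)) (q i - q j) := by
  unfold d2Potential
  have hij : i ≠ j := by intro e; subst e; omega
  simp only [hij, if_false, mul_zero, zero_add]
  have key : ∀ k l : Fin N,
      (if l.val = k.val + 1 then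
        deriv (deriv (P.V k.val)) (q l - q k) * ((if l = j then 1 else 0) - (if k = j then 1 else 0)) *
          ((if l = i then 1 else 0) - (if k = i then 1 else 0)) else (0 : ℝ)) =
      if k = j then (if l = i then -deriv (deriv (P.V k.val)) (q l - q k) else 0) else 0 := by
    intro k l
    simp only [Fin.ext_iff]
    split_ifs <;> first | (exfalso; omega) | simp
  simp_rw [key]
  simp

/-! ### The Fokker–Planck drift `X₀ = -Y` -/

/-- The vector field `X₀ = -Y` of the Fokker–Planck operator `L* = ∑_b X_b² - Y + 2γ` (the formal
adjoint of the generator `L = Y + ∑_b X_b²`; `div Y = -2γ`), `Y = P.langevinDrift N` the Langevin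
drift of the site chain. [cite: CuneoEckmannHairerReyBellet2018, §3.1] -/
def adjointLangevinDrift (N : ℕ) (x : PhaseSpace N) : PhaseSpace N :=
  -P.langevinDrift N x

/-- Closed form `X₀(q, p) = (-p, ∇Φ(q) + γ 1_B p)` for differentiable potentials. [folklore] -/
theorem adjointLangevinDrift_eq (hU : ∀ i, Differentiable ℝ (P.U i))
    (hV : ∀ i, Differentiable ℝ (P.V i)) (N : ℕ) :
    P.adjointLangevinDrift N = fun x =>
      (-x.2, fun i => P.dPotential N i x.1 + P.γ * OscillatorChain.bathWeight N i * x.2 i) := by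
  funext x
  simp only [adjointLangevinDrift, P.langevinDrift_eq hU hV, Prod.neg_mk]
  congr 1
  funext i
  simp only [Pi.neg_apply]
  ring

/-- `X₀ = -Y` is smooth for smooth potentials. [folklore] -/
theorem contDiff_adjointLangevinDrift (hU : ∀ i, ContDiff ℝ ∞ (P.U i))
    (hV : ∀ i, ContDiff ℝ ∞ (P.V i)) (N : ℕ) : ContDiff ℝ ∞ (P.adjointLangevinDrift N) := by
  have hUd : ∀ i, Differentiable ℝ (P.U i) := fun i => (hU i).differentiable (by simp)
  have hVd : ∀ i, Differentiable ℝ (P.V i) := fun i => (hV i).differentiable (by simp)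
  rw [P.adjointLangevinDrift_eq hUd hVd]
  refine contDiff_snd.neg.prodMk (contDiff_pi.2 fun i => ?_)
  exact ((P.contDiff_dPotential_of_succ hU hV N i).comp contDiff_fst).add
    (contDiff_const.mul ((contDiff_apply ℝ ℝ i).comp contDiff_snd))

/-- `∂X₀/∂p_j = (-e_j, γ ([j = 0] + [j = N-1]) e_j)`. [folklore] -/
theorem hasLineDerivAt_adjointLangevinDrift_unitP (hU : ∀ i, ContDiff ℝ ∞ (P.U i))
    (hV : ∀ i, ContDiff ℝ ∞ (P.V i)) (N : ℕ) (x : PhaseSpace N) (j : Fin N) :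
    HasLineDerivAt ℝ (P.adjointLangevinDrift N)
      ((-Pi.single j 1, fun i => if i = j then P.γ * OscillatorChain.bathWeight N i else 0) :
        PhaseSpace N) x (unitP j) := by
  have hUd : ∀ i, Differentiable ℝ (P.U i) := fun i => (hU i).differentiable (by simp)
  have hVd : ∀ i, Differentiable ℝ (P.V i) := fun i => (hV i).differentiable (by simp)
  unfold HasLineDerivAt
  rw [P.adjointLangevinDrift_eq hUd hVd]
  simp only [unitP_eq, add_smul_unitP_fst, add_smul_unitP_snd]
  have hlin : HasDerivAt (fun t : ℝ => x.2 + t • (Pi.single j (1 : ℝ) : Fin N → ℝ))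
      (Pi.single j 1) 0 := by
    simpa using ((hasDerivAt_id (0 : ℝ)).smul_const (Pi.single j (1 : ℝ) : Fin N → ℝ)).const_add
      x.2
  have hco : ∀ m : Fin N, HasDerivAt (fun t : ℝ => (x.2 + t • (Pi.single j (1 : ℝ) : Fin N → ℝ)) m)
      (if m = j then 1 else 0) 0 := fun m => by
    have := (hasDerivAt_pi.1 hlin) m
    simpa [Pi.single_apply] using this
  refine hlin.neg.prodMk (hasDerivAt_pi.2 fun i => ?_)
  have h2 := ((hco i).const_mul (P.γ * OscillatorChain.bathWeight N i)).const_add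
    (P.dPotential N i x.1)
  convert h2 using 1
  split_ifs <;> ring

/-- `∂X₀/∂q_j = (0, (∂²Φ/∂q_j∂q_i)_i)`. [folklore] -/
theorem hasLineDerivAt_adjointLangevinDrift_unitQ (hU : ∀ i, ContDiff ℝ ∞ (P.U i))
    (hV : ∀ i, ContDiff ℝ ∞ (P.V i)) (N : ℕ) (x : PhaseSpace N) (j : Fin N) :
    HasLineDerivAt ℝ (P.adjointLangevinDrift N)
      ((0, fun i => P.d2Potential N i j x.1) : PhaseSpace N) x (unitQ j) := by
  have hUd : ∀ i, Differentiable ℝ (P.U i) := fun i => (hU i).differentiable (by simp)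
  have hVd : ∀ i, Differentiable ℝ (P.V i) := fun i => (hV i).differentiable (by simp)
  unfold HasLineDerivAt
  rw [P.adjointLangevinDrift_eq hUd hVd]
  simp only [unitQ_eq, add_smul_unitQ_fst, add_smul_unitQ_snd]
  refine (hasDerivAt_const (0 : ℝ) (-x.2)).prodMk (hasDerivAt_pi.2 fun i => ?_)
  have hU' : ∀ i, ContDiff ℝ ∞ (deriv (P.U i)) := fun i => (hU i).deriv'
  have hV' : ∀ i, ContDiff ℝ ∞ (deriv (P.V i)) := fun i => (hV i).deriv'
  have hU2 : ∀ i, Differentiable ℝ (deriv (P.U i)) := fun i => (hU' i).differentiable (by simp)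
  have hV2 : ∀ i, Differentiable ℝ (deriv (P.V i)) := fun i => (hV' i).differentiable (by simp)
  have h := (P.hasDerivAt_d2Potential hU2 hV2 N x.1 i j).add_const
    (P.γ * OscillatorChain.bathWeight N i * x.2 i)
  simpa using h

/-- **The derivative of `X₀`**: `DX₀(x) v = (-v.2, Hess Φ(q) v.1 + γ 1_B v.2)`, i.e.
`(DX₀(x) v).1 = -v.2` and `(DX₀(x) v).2 i = ∑_j ∂²Φ/∂q_j∂q_i v.1 j + γ ([i=0]+[i=N-1]) v.2 i`.
[folklore] -/
theorem fderiv_adjointLangevinDrift_apply (hU : ∀ i, ContDiff ℝ ∞ (P.U i))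
    (hV : ∀ i, ContDiff ℝ ∞ (P.V i)) (N : ℕ) (x v : PhaseSpace N) :
    fderiv ℝ (P.adjointLangevinDrift N) x v =
      (-v.2, fun i => (∑ j, P.d2Potential N i j x.1 * v.1 j) +
        P.γ * OscillatorChain.bathWeight N i * v.2 i) := by
  have hd : DifferentiableAt ℝ (P.adjointLangevinDrift N) x :=
    ((P.contDiff_adjointLangevinDrift hU hV N).differentiable (by simp)) x
  have hQ : ∀ j, fderiv ℝ (P.adjointLangevinDrift N) x (unitQ j) =
      ((0, fun i => P.d2Potential N i j x.1) : PhaseSpace N) := fun j => by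
    rw [← hd.lineDeriv_eq_fderiv]
    exact (P.hasLineDerivAt_adjointLangevinDrift_unitQ hU hV N x j).lineDeriv
  have hP : ∀ j, fderiv ℝ (P.adjointLangevinDrift N) x (unitP j) =
      ((-Pi.single j 1, fun i => if i = j then P.γ * OscillatorChain.bathWeight N i else 0) :
        PhaseSpace N) :=
    fun j => by
    rw [← hd.lineDeriv_eq_fderiv]
    exact (P.hasLineDerivAt_adjointLangevinDrift_unitP hU hV N x j).lineDeriv
  rw [clm_apply_eq_sum]
  simp only [hQ, hP]
  ext i
  · simp [Prod.fst_sum, Finset.sum_apply, Pi.single_apply]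
  · simp only [Prod.snd_add, Prod.snd_sum, Prod.smul_snd, Finset.sum_apply, Pi.add_apply,
      Pi.smul_apply, smul_eq_mul, mul_ite, mul_zero, Finset.sum_ite_eq, Finset.mem_univ, if_true]
    rw [Finset.sum_congr rfl fun j _ => mul_comm (v.1 j) (P.d2Potential N i j x.1)]
    ring

/-- **The divergence of `X₀`** is the constant `γ ∑_i ([i=0]+[i=N-1]) = 2γ` (`N ≥ 1`): only the
friction terms `γ p_b ∂_{p_b}` contribute to `tr DX₀`. [folklore] -/
theorem fieldDiv_adjointLangevinDrift (hU : ∀ i, ContDiff ℝ ∞ (P.U i))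
    (hV : ∀ i, ContDiff ℝ ∞ (P.V i)) (hN : 0 < N) (x : PhaseSpace N) :
    fieldDiv (P.adjointLangevinDrift N) x = 2 * P.γ := by
  unfold fieldDiv
  classical
  let b := (Pi.basisFun ℝ (Fin N)).prod (Pi.basisFun ℝ (Fin N))
  rw [LinearMap.trace_eq_matrix_trace ℝ b, Matrix.trace]
  simp only [Matrix.diag_apply, LinearMap.toMatrix_apply, ContinuousLinearMap.coe_coe,
    Fintype.sum_sum_type, b, Module.Basis.prod_repr_inl, Module.Basis.prod_repr_inr,
    Pi.basisFun_repr, Module.Basis.prod_apply, Pi.basisFun_apply, Sum.elim_inl, Sum.elim_inr,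
    LinearMap.coe_inl, LinearMap.coe_inr, Function.comp_apply]
  simp only [P.fderiv_adjointLangevinDrift_apply hU hV]
  simp only [Pi.zero_apply, Finset.sum_const_zero, zero_add, mul_zero, neg_zero, Pi.neg_apply,
    Pi.single_eq_same, mul_one, ← Finset.mul_sum, OscillatorChain.sum_bathWeight hN]
  ring

/-! ### The generator as the transpose of a Hörmander-type operator -/

/-- The constant noise vector fields `X_b = √(γ T_b) ∂_{p_b}` of the two baths of the site chain
(CEHRB §3, `X_{b,i} = √(T_b γ_b) ∂_{p_b^i}`), so that `∑_b X_b² = γ (T_L ∂²_{p_0} + T_R ∂²_{p_{N-1}})`.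
[cite: CuneoEckmannHairerReyBellet2018, eq. (3.2)] -/
def langevinBathField (hN : 0 < N) (T_L T_R : ℝ) (b : Fin 2) (_x : PhaseSpace N) : PhaseSpace N :=
  Real.sqrt (P.γ * OscillatorChain.bathTemp T_L T_R b) • unitP (OscillatorChain.bathSite hN b)

/-- **The generator of the site chain is the formal transpose of its Fokker–Planck operator
written in Hörmander's form (1.6)**: with `X₀ = -Y`, `X_b = √(γT_b) ∂_{p_b}` (`b ∈ {L, R}`) and
`c = 2γ`, the operator `P = ∑_b X_b² + X₀ + c = L*` satisfies `ᵗP f = L f` for every smooth `f`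
(`γ T_L, γ T_R ≥ 0`). [cite: CuneoEckmannHairerReyBellet2018, eq. (3.2) and §3.1] -/
theorem hormanderTranspose_eq_generator (hU : ∀ i, ContDiff ℝ ∞ (P.U i))
    (hV : ∀ i, ContDiff ℝ ∞ (P.V i)) (hN : 0 < N) {T_L T_R : ℝ} (hL : 0 ≤ P.γ * T_L)
    (hR : 0 ≤ P.γ * T_R) {f : PhaseSpace N → ℝ} (hf : ContDiff ℝ ∞ f) :
    hormanderTranspose (P.adjointLangevinDrift N) (P.langevinBathField hN T_L T_R)
      (fun _ => 2 * P.γ) f = P.generator N T_L T_R f := by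
  have hfd : Differentiable ℝ f := hf.differentiable (by simp)
  have hfd1 : ∀ i, Differentiable ℝ (partialP i f) := fun i =>
    (contDiff_partialP hf (m := ∞) (by exact_mod_cast le_top) i).differentiable (by simp)
  funext x
  rw [P.generator_eq_fderiv_langevinDrift_add N T_L T_R hfd x, hormanderTranspose,
    Fin.sum_univ_two]
  -- second-order terms
  have hPP : ∀ i, partialP i (partialP i f) x =
      fderiv ℝ (fun y => fderiv ℝ f y (unitP i)) x (unitP i) := fun i => by
    rw [partialP_eq_fderiv (hfd1 i), partialP_eq_fderiv hfd, unitP_eq]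
  have hb : ∀ b : Fin 2, fieldTranspose (P.langevinBathField hN T_L T_R b)
      (fieldTranspose (P.langevinBathField hN T_L T_R b) f) x =
      P.γ * OscillatorChain.bathTemp T_L T_R b * partialP (OscillatorChain.bathSite hN b)
        (partialP (OscillatorChain.bathSite hN b) f) x := by
    intro b
    unfold langevinBathField
    rw [fieldTranspose_fieldTranspose_const_smul _ _ hf, hPP, Real.mul_self_sqrt]
    fin_cases b
    · exact hL
    · exact hR
  -- first-order term: `ᵗX₀ f = Y·∇f - 2γ f`
  have h0 : fieldTranspose (P.adjointLangevinDrift N) f x =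
      fderiv ℝ f x (P.langevinDrift N x) - 2 * P.γ * f x := by
    rw [fieldTranspose, fieldDeriv, P.fieldDiv_adjointLangevinDrift hU hV hN, adjointLangevinDrift,
      map_neg]
    ring
  rw [hb, hb, h0]
  -- the sum over sites of the generator picks the two bath sites
  have hsum : ∑ i : Fin N, ((if i.val = 0 then T_L else 0) + (if i.val = N - 1 then T_R else 0)) *
      partialP i (partialP i f) x =
      T_L * partialP (OscillatorChain.bathSite hN 0) (partialP (OscillatorChain.bathSite hN 0) f) x +
        T_R * partialP (OscillatorChain.bathSite hN 1)
          (partialP (OscillatorChain.bathSite hN 1) f) x := by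
    simp only [add_mul, Finset.sum_add_distrib]
    congr 1
    · rw [Finset.sum_eq_single_of_mem (OscillatorChain.bathSite hN 0) (mem_univ _)]
      · simp [OscillatorChain.bathSite]
      · intro b _ hb
        rw [if_neg, zero_mul]
        exact fun h => hb (Fin.ext (by simpa [OscillatorChain.bathSite] using h))
    · rw [Finset.sum_eq_single_of_mem (OscillatorChain.bathSite hN 1) (mem_univ _)]
      · simp [OscillatorChain.bathSite]
      · intro b _ hb
        rw [if_neg, zero_mul]
        exact fun h => hb (Fin.ext (by simpa [OscillatorChain.bathSite] using h))
  rw [hsum]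
  simp only [OscillatorChain.bathTemp, Matrix.cons_val_zero, Matrix.cons_val_one]
  ring

/-! ### Hörmander's family and the iterated brackets -/

/-- The family `(X₀ = -Y, X_L, X_R)` of Hörmander's Theorem 1.1 for the Fokker–Planck operator
`L* = X_L² + X_R² + X₀ + 2γ` of the site chain, indexed by `Option (Fin 2)` as in
`Literature.Analysis.Distribution.Hormander1967_thm11`. [cite: CuneoEckmannHairerReyBellet2018, Prop 4.1] -/
def langevinHormanderFamily (hN : 0 < N) (T_L T_R : ℝ) :
    Option (Fin 2) → PhaseSpace N → PhaseSpace N :=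
  fun o => o.elim (P.adjointLangevinDrift N) (P.langevinBathField hN T_L T_R)

/-- The iterated brackets `Z_0 = X_L`, `Z_{k+1} = [X₀, Z_k]` along which the bracket condition is
verified (CEHRB, proof of Prop. 4.1: commutators with `X₀` propagate `∂_{p_0}` through the chain).
[cite: CuneoEckmannHairerReyBellet2018, Prop 4.1] -/
def langevinBracketSeq (hN : 0 < N) (T_L T_R : ℝ) : ℕ → PhaseSpace N → PhaseSpace N
  | 0 => P.langevinBathField hN T_L T_R 0
  | k + 1 => VectorField.lieBracket ℝ (P.adjointLangevinDrift N) (langevinBracketSeq hN T_L T_R k)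

/-- All fields of the family `(X₀, X_L, X_R)` are smooth (smooth potentials). [folklore] -/
theorem contDiff_langevinHormanderFamily (hU : ∀ i, ContDiff ℝ ∞ (P.U i))
    (hV : ∀ i, ContDiff ℝ ∞ (P.V i)) (hN : 0 < N) (T_L T_R : ℝ) :
    ∀ o, ContDiff ℝ ∞ (P.langevinHormanderFamily hN T_L T_R o) := by
  rintro (_ | b)
  · exact P.contDiff_adjointLangevinDrift hU hV N
  · exact contDiff_const

/-- Each `Z_k` is an iterated Lie bracket of the family `(X₀, X_L, X_R)`. [folklore] -/
theorem isIteratedLieBracket_langevinBracketSeq (hN : 0 < N) (T_L T_R : ℝ) (k : ℕ) :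
    IsIteratedLieBracket (P.langevinHormanderFamily hN T_L T_R)
      (P.langevinBracketSeq hN T_L T_R k) := by
  induction k with
  | zero => exact IsIteratedLieBracket.of (some 0)
  | succ k ih => exact IsIteratedLieBracket.lieBracket none ih

/-- `Z_0 = √(γT_L) ∂_{p_0}`. [folklore] -/
theorem langevinBracketSeq_zero_apply (hN : 0 < N) (T_L T_R : ℝ) (x : PhaseSpace N) :
    P.langevinBracketSeq hN T_L T_R 0 x = Real.sqrt (P.γ * T_L) • unitP ⟨0, hN⟩ :=
  rfl

/-- The recursion `Z_{k+1}(x) = DZ_k(x)·X₀(x) - DX₀(x)·Z_k(x)` (`[X₀, Z] = DZ·X₀ - DX₀·Z`).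
[folklore] -/
theorem langevinBracketSeq_succ_apply (hN : 0 < N) (T_L T_R : ℝ) (k : ℕ) (x : PhaseSpace N) :
    P.langevinBracketSeq hN T_L T_R (k + 1) x =
      fderiv ℝ (P.langevinBracketSeq hN T_L T_R k) x (P.adjointLangevinDrift N x) -
        fderiv ℝ (P.adjointLangevinDrift N) x (P.langevinBracketSeq hN T_L T_R k x) := by
  show VectorField.lieBracket ℝ (P.adjointLangevinDrift N) (P.langevinBracketSeq hN T_L T_R k) x = _
  rw [VectorField.lieBracket_eq]

/-- `Z_{k+1}` is smooth if `Z_k` is (smooth potentials). [folklore] -/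
theorem contDiff_langevinBracketSeq (hU : ∀ i, ContDiff ℝ ∞ (P.U i))
    (hV : ∀ i, ContDiff ℝ ∞ (P.V i)) (hN : 0 < N) (T_L T_R : ℝ) (k : ℕ) :
    ContDiff ℝ ∞ (P.langevinBracketSeq hN T_L T_R k) := by
  induction k with
  | zero => exact contDiff_const
  | succ k ih =>
    exact (P.contDiff_adjointLangevinDrift hU hV N).lieBracket_vectorField ih
      (by exact_mod_cast le_top)

end SiteChain

end Literature.MathematicalPhysics.KineticTheory.HeatConduction
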